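import Summits.ResolutionOfSingularities.ResolutionOfSingularities.Theorems.EquisingularLiftEquisingularLiftBlowupModelOrdinaryPoints
import Summits.ResolutionOfSingularities.ResolutionOfSingularities.Theorems.EquisingularLiftEquisingularLiftNatMultiOrdinaryPointsJacobian
import Summits.ResolutionOfSingularities.ResolutionOfSingularities.Theorems.EquisingularLiftEquisingularLiftBlowupModelQuadricsOfNormalForm
import Summits.ResolutionOfSingularities.ResolutionOfSingularities.Theorems.EquisingularLiftEquisingularLiftNatELNatAtLinSubst
import HarnessLib

/-!
# [OURS] ORDINARY MULTIPLE POINTS IN LINEARLY GENERAL POSITION — BOTH CURRENCIES, ANY LINEAR COORDINATES, CLASSICAL JACOBIAN HYPOTHESES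
# (crux `EquisingularLift` stmt-ResolutionOfSingularities-15660: regular blow-up models; cruxes `EquisingularLiftNat(Three)` -20038 / -20148: `ELNatAt`)

[OURS · leafhand-res-equisingularlift-7 g1, 2026-08-31; cell `pub/decomp-res`] AI-produced, weaker than expert review; NOT a statement of any manuscript;
nothing here proves resolution of singularities in positive characteristic.  DEF-FREE helper; no `sorry`; standard axioms; ZERO named hypotheses.

Composition of ✓ `MultiOrd.isRegular_of_isBlowup_comap_prod` / `StrataSplit.blowupModel_ordinaryPoints` (p823884, every field),
✓ `MultiOrd.elNatAt_ordinaryPoints_of_jacobian` / `hsing_of_jacobian` / `isRegularRing_chartRing_of_jacobian` (…NatMultiOrdinaryPointsJacobian) and the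
tree's `PGL`-transport (✓ `QuadricELNat.elNatAt_of_elNatAt_linSubst`, ✓ `exists_closedImmersion_range_eq_of_linSubst`, ✓ `prime_aeval_of_linSubst`):

* ★ `StrataSplit.blowupModel_ordinaryPoints_of_jacobian` — `K = K̄` (any characteristic), `F` a prime form in `m + 3` variables, `S` duplicate-free,
  (ord) ordinary multiple points at the marked vertices, (jac) «every `a ≠ 0` with `F(a) = 0`, `∇F(a) = 0` is a multiple of a marked vertex»:
  **`V₊(F)` has a non-zero ideal sheaf all of whose blow-ups are regular** (conclusion of the OPEN residual `stub_blowupModel_ge_five` at these `H`);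
  `…_of_range_eq_…` the crux's binder shape `(H, ι)`;
* ★★ `StrataSplit.blowupModel_of_range_eq_of_linSubst_ordinaryPoints_of_jacobian` and ★★ `MultiOrd.elNatAt_of_linSubst_ordinaryPoints_of_jacobian` —
  **the same two conclusions for every `(H, ι)`, `range ι = V₊(F)`, as soon as in SOME linear coordinate system `σ_{τ'} F` satisfies (ord) + (jac)**:
  every integral hypersurface of `ℙ^{m+2}_{K̄}` (any `m`, any degree, any `p`) whose singular points are finitely many ORDINARY MULTIPLE POINTS IN LINEARLY
  GENERAL POSITION (`≤ m + 3` of them, moved to coordinate vertices by `PGL_{m+3}`) — e.g. every nodal hypersurface with nodes in general position, in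
  particular (classically) every cubic surface with only `A₁` singularities.

Honest label: closes no registered stub.  What a user still supplies per surface: the substitution `τ, τ'`, the splitting `Φ_c + Ψ_c` at each marked
vertex with `Φ_c` nonsingular, and the closed-point Jacobian computation (jac) — all three finite polynomial identities / case analyses.

References: [Hartshorne1977, I Thm. 5.1, I Ex. 5.8, II Example 7.1.1, II Ex. 7.12]; [StacksProject, Tags 07PF, 080A, 0804]; [Matsumura1987, Thm. 14.2].
-/

set_option linter.dupNamespace false -- mandated namespace `Summit.<Summit>.<Problem>` of this single-conjunct summit

noncomputable section

open CategoryTheory CategoryTheory.Limits AlgebraicGeometry TopologicalSpace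
open MvPolynomial HomogeneousLocalization
open Literature.AlgebraicGeometry.Resolution
open Literature.AlgebraicGeometry.Motives Literature.AlgebraicGeometry.Motives.SmoothHypersurface
open Literature.AlgebraicGeometry.Motives.ProjectiveSpace
open AlgebraicGeometry.Scheme.IdealSheafData

namespace Summit.ResolutionOfSingularities.ResolutionOfSingularities.Cruxes.EquisingularLift.StrataSplit

open Summit.ResolutionOfSingularities.ResolutionOfSingularities.Cruxes.EquisingularLiftNat.Sections
open Summit.ResolutionOfSingularities.ResolutionOfSingularities.Cruxes.EquisingularLiftNat

/-! ## Regular blow-up models under the classical Jacobian condition -/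

/-- ★ **Hypersurfaces whose singular points are ordinary multiple points at coordinate vertices have regular blow-up models — classical Jacobian form**
(`K` algebraically closed, any characteristic, any dimension): `F` a prime form, `S` duplicate-free, (ord) at the marked vertices, (jac) the singular closed
points are among the marked vertices.  ✓ `blowupModel_ordinaryPoints` with (hsing)/(hoffS) supplied by ✓ `MultiOrd.hsing_of_jacobian` /
✓ `MultiOrd.isRegularRing_chartRing_of_jacobian`. [cite: Hartshorne1977, I Thm. 5.1, II Ex. 7.12] [cite: StacksProject, Tag 080A] -/
theorem blowupModel_ordinaryPoints_of_jacobian (K : Type) [Field K] [IsAlgClosed K] {m : ℕ} (F : MvPolynomial (Fin (m + 2 + 1)) K) {d : ℕ}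
    (hF : F.IsHomogeneous d) (hFp : Prime F) (S : List (Fin (m + 2 + 1))) (hS : S.Nodup)
    (hord : ∀ c ∈ S, ∃ (μ : ℕ) (Φ Ψ : MvPolynomial (Fin (m + 2)) K), 1 ≤ μ ∧ Φ.IsHomogeneous μ ∧ IsNonsingularForm K Φ ∧
      Ψ ∈ Ideal.span (Set.range (X : Fin (m + 2) → MvPolynomial (Fin (m + 2)) K)) ^ (μ + 1) ∧ ProjectiveSpace.dehomogenize K c F = Φ + Ψ)
    (hjac : ∀ a : Fin (m + 2 + 1) → K, a ≠ 0 → eval a F = 0 → (∀ i, eval a (pderiv i F) = 0) → ∃ c ∈ S, ∀ i, i ≠ c → a i = 0) :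
    letI := MvPolynomial.gradedAlgebra (σ := Fin (m + 2 + 1)) (R := K)
    ∃ 𝔞 : (hypersurface F).left.IdealSheafData, 𝔞 ≠ ⊥ ∧
      ∀ (Z : Scheme.{0}) (π : Z ⟶ (hypersurface F).left), IsBlowup π 𝔞 → Scheme.IsRegular Z :=
  blowupModel_ordinaryPoints K F hF hFp S hS hord (fun c _ P hP hf hPj j => MultiOrd.hsing_of_jacobian F hF S hjac c P hP hf hPj j)
    (fun c hc => MultiOrd.isRegularRing_chartRing_of_jacobian F hF S hjac hFp c hc)

/-- ★ **The same in the crux's binder shape `(H, ι)`**, `range ι = V₊(F)` (✓ `blowupModel_of_range_eq`). [cite: Hartshorne1977, II Ex. 7.12] -/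
theorem blowupModel_of_range_eq_ordinaryPoints_of_jacobian {K : Type} [Field K] [IsAlgClosed K] {m : ℕ} {H : Scheme.{0}}
    (ι : H ⟶ (projectiveSpace (m + 2) K).left) [IsClosedImmersion ι] [IsIntegral H]
    (F : MvPolynomial (Fin (m + 2 + 1)) K) {d : ℕ} (hF : F.IsHomogeneous d) (hFp : Prime F) (S : List (Fin (m + 2 + 1))) (hS : S.Nodup)
    (hord : ∀ c ∈ S, ∃ (μ : ℕ) (Φ Ψ : MvPolynomial (Fin (m + 2)) K), 1 ≤ μ ∧ Φ.IsHomogeneous μ ∧ IsNonsingularForm K Φ ∧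
      Ψ ∈ Ideal.span (Set.range (X : Fin (m + 2) → MvPolynomial (Fin (m + 2)) K)) ^ (μ + 1) ∧ ProjectiveSpace.dehomogenize K c F = Φ + Ψ)
    (hjac : ∀ a : Fin (m + 2 + 1) → K, a ≠ 0 → eval a F = 0 → (∀ i, eval a (pderiv i F) = 0) → ∃ c ∈ S, ∀ i, i ≠ c → a i = 0)
    (hrange : letI := MvPolynomial.gradedAlgebra (σ := Fin (m + 2 + 1)) (R := K)
      Set.range ι = {x : Proj (homogeneousSubmodule (Fin (m + 2 + 1)) K) | F ∈ x.asHomogeneousIdeal}) :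
    ∃ 𝔞 : H.IdealSheafData, 𝔞 ≠ ⊥ ∧ ∀ (Z : Scheme.{0}) (π : Z ⟶ H), IsBlowup π 𝔞 → Scheme.IsRegular Z :=
  letI := MvPolynomial.gradedAlgebra (σ := Fin (m + 2 + 1)) (R := K)
  blowupModel_of_range_eq ι F hF hFp hrange (blowupModel_ordinaryPoints_of_jacobian K F hF hFp S hS hord hjac)

/-! ## Any linear coordinates -/

/-- ★★ **Every `(H, ι)` of the crux whose image has, IN SOME LINEAR COORDINATES, only ordinary multiple points at coordinate vertices as singular points
has a regular blow-up model** — `K = K̄`, any characteristic, any dimension, any degree: `range ι = V₊(F)`, `τ, τ'` mutually inverse linear substitutions,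
`G := σ_{τ'} F` satisfying (ord) + (jac) (then `G` is a prime form of the same degree, ✓ `prime_aeval_of_linSubst`; `(H, ι ≫ α_τ)` has image `V₊(G)`,
✓ `exists_closedImmersion_range_eq_of_linSubst`).  In particular every integral hypersurface whose singular points are `≤ m + 3` ordinary multiple points
in linearly general position. [cite: Hartshorne1977, II Example 7.1.1, II Ex. 7.12] -/
theorem blowupModel_of_range_eq_of_linSubst_ordinaryPoints_of_jacobian {K : Type} [Field K] [IsAlgClosed K] {m : ℕ} {H : Scheme.{0}}
    (ι : H ⟶ (projectiveSpace (m + 1 + 1) K).left) [IsClosedImmersion ι] [IsIntegral H]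
    (F : MvPolynomial (Fin (m + 1 + 1 + 1)) K) {d : ℕ} (hF : F.IsHomogeneous d) (hFp : Prime F)
    (hrange : letI := MvPolynomial.gradedAlgebra (σ := Fin (m + 1 + 1 + 1)) (R := K)
      Set.range ι = {x : Proj (homogeneousSubmodule (Fin (m + 1 + 1 + 1)) K) | F ∈ x.asHomogeneousIdeal})
    (τ τ' : Fin (m + 1 + 1 + 1) → MvPolynomial (Fin (m + 1 + 1 + 1)) K) (hτ : ∀ i, (τ i).IsHomogeneous 1) (hτ' : ∀ i, (τ' i).IsHomogeneous 1)
    (hinv : ∀ i, aeval τ (τ' i) = X i) (hinv' : ∀ i, aeval τ' (τ i) = X i)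
    (S : List (Fin (m + 2 + 1))) (hS : S.Nodup)
    (hord : ∀ c ∈ S, ∃ (μ : ℕ) (Φ Ψ : MvPolynomial (Fin (m + 2)) K), 1 ≤ μ ∧ Φ.IsHomogeneous μ ∧ IsNonsingularForm K Φ ∧
      Ψ ∈ Ideal.span (Set.range (X : Fin (m + 2) → MvPolynomial (Fin (m + 2)) K)) ^ (μ + 1) ∧
        ProjectiveSpace.dehomogenize K c (aeval τ' F) = Φ + Ψ)
    (hjac : ∀ a : Fin (m + 2 + 1) → K, a ≠ 0 → eval a (aeval τ' F) = 0 → (∀ i, eval a (pderiv i (aeval τ' F)) = 0) →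
      ∃ c ∈ S, ∀ i, i ≠ c → a i = 0) :
    ∃ 𝔞 : H.IdealSheafData, 𝔞 ≠ ⊥ ∧ ∀ (Z : Scheme.{0}) (π : Z ⟶ H), IsBlowup π 𝔞 → Scheme.IsRegular Z := by
  letI := MvPolynomial.gradedAlgebra (σ := Fin (m + 1 + 1 + 1)) (R := K)
  obtain ⟨ι₁, hι₁, hrange₁⟩ := exists_closedImmersion_range_eq_of_linSubst τ τ' hτ hτ' hinv hinv' ι F hrange
  haveI := hι₁
  have hG : (aeval τ' F).IsHomogeneous d := by
    have h := hF.aeval τ' hτ'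
    rwa [one_mul] at h
  exact blowupModel_of_range_eq_ordinaryPoints_of_jacobian ι₁ (aeval τ' F) hG (prime_aeval_of_linSubst τ τ' hinv hinv' hFp) S hS hord hjac hrange₁

end Summit.ResolutionOfSingularities.ResolutionOfSingularities.Cruxes.EquisingularLift.StrataSplit

namespace Summit.ResolutionOfSingularities.ResolutionOfSingularities.Cruxes.EquisingularLiftNat.Sections

namespace MultiOrd

open Summit.ResolutionOfSingularities.ResolutionOfSingularities.Cruxes.EquisingularLift.StrataSplit

/-- ★★ **EL♮ (`ELNatAt`) for every `(H, ι)` of the crux whose image has, IN SOME LINEAR COORDINATES, only ordinary multiple points at coordinate vertices as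
singular points** — `K = K̄` of characteristic `p`, any dimension, any degree: `range ι = V₊(F)`, `τ, τ'` mutually inverse linear substitutions, `G := σ_{τ'} F`
satisfying (ord) + (jac); ✓ `elNatAt_ordinaryPoints_of_jacobian` for `V₊(G)` travels back along `α_τ ∈ PGL_{m+3}(K)` (✓ `QuadricELNat.elNatAt_of_elNatAt_linSubst`).
In particular every integral hypersurface whose singular points are `≤ m + 3` ordinary multiple points in linearly general position — e.g. nodal hypersurfaces
with nodes in general position; classically every cubic surface with only `A₁` points. [OURS · L1 W4.5b] [cite: Hartshorne1977, I Thm. 5.1, II Example 7.1.1] -/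
theorem elNatAt_of_linSubst_ordinaryPoints_of_jacobian {K : Type} [Field K] (p : ℕ) (hp : p.Prime) [CharP K p] [IsAlgClosed K] {m : ℕ}
    {H : Scheme.{0}} (ι : H ⟶ (projectiveSpace (m + 1 + 1) K).left) [IsClosedImmersion ι]
    (F : MvPolynomial (Fin (m + 1 + 1 + 1)) K) {d : ℕ} (hF : F.IsHomogeneous d) (hFp : Prime F)
    (hrange : letI := MvPolynomial.gradedAlgebra (σ := Fin (m + 1 + 1 + 1)) (R := K)
      Set.range ι = {x : Proj (homogeneousSubmodule (Fin (m + 1 + 1 + 1)) K) | F ∈ x.asHomogeneousIdeal})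
    (τ τ' : Fin (m + 1 + 1 + 1) → MvPolynomial (Fin (m + 1 + 1 + 1)) K) (hτ : ∀ i, (τ i).IsHomogeneous 1) (hτ' : ∀ i, (τ' i).IsHomogeneous 1)
    (hinv : ∀ i, aeval τ (τ' i) = X i) (hinv' : ∀ i, aeval τ' (τ i) = X i)
    (S : List (Fin (m + 2 + 1))) (hS : S.Nodup)
    (hord : ∀ c ∈ S, ∃ (μ : ℕ) (Φ Ψ : MvPolynomial (Fin (m + 2)) K), 1 ≤ μ ∧ Φ.IsHomogeneous μ ∧ IsNonsingularForm K Φ ∧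
      Ψ ∈ Ideal.span (Set.range (X : Fin (m + 2) → MvPolynomial (Fin (m + 2)) K)) ^ (μ + 1) ∧
        ProjectiveSpace.dehomogenize K c (aeval τ' F) = Φ + Ψ)
    (hjac : ∀ a : Fin (m + 2 + 1) → K, a ≠ 0 → eval a (aeval τ' F) = 0 → (∀ i, eval a (pderiv i (aeval τ' F)) = 0) →
      ∃ c ∈ S, ∀ i, i ≠ c → a i = 0) :
    Theorems.EquisingularLift.ELNatAt p K (m + 1 + 1) H ι := by
  have hG : (aeval τ' F).IsHomogeneous d := by
    have h := hF.aeval τ' hτ'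
    rwa [one_mul] at h
  exact QuadricELNat.elNatAt_of_elNatAt_linSubst τ τ' hτ hτ' hinv hinv' p ι F hrange
    (elNatAt_ordinaryPoints_of_jacobian (aeval τ' F) hG S hjac p hp (prime_aeval_of_linSubst τ τ' hinv hinv' hFp) hS hord)

end MultiOrd

end Summit.ResolutionOfSingularities.ResolutionOfSingularities.Cruxes.EquisingularLiftNat.Sections

end
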